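import Mathlib.LinearAlgebra.Matrix.SpecialLinearGroup
import Mathlib.Analysis.Complex.UpperHalfPlane.Basic
import Mathlib.Analysis.SpecialFunctions.Trigonometric.Basic
import Mathlib.Data.EReal.Basic
import Mathlib.Data.ZMod.Basic
import Mathlib.Algebra.BigOperators.Fin
import HarnessLib

/-!
# Joshi's geometric case II (arXiv:2401.13508 v4, §§12.9–12.18): log-Θ-lattice, Schottky Hodge structures, the loci `Θ_classical`,
# the stabilized height `h`, `|Θ_classical(D)|` (Def. 12.16.1), Lemma 12.16.2, the monodromy lifts (§12.17) and Theorem 12.18.1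
# «Mochizuki's Corollary 3.12 in the geometric case» — TYPED, no side taken

Record file of the abc-iut cell, branch E «type Joshi's construction, test vs S» (rung LADDER-ABC:A2.E; seat abc-iut-E-t36, slot T-36;
nodes J3:Rmk12.9.1, Rmk12.10.1, Lem12.10.2, Rmk12.14.2, Def12.16.1, Lem12.16.2, Rmk12.16.3, Thm12.18.1, Rmk12.18.2 of plan/E/JOSHI-DAG.tsv).
Source: K. Joshi, *Construction of Arithmetic Teichmuller Spaces III*, arXiv:2401.13508 **v4**, "Preliminary version for comments",
UNREFEREED (bib `Joshi2024ATS3`; a dispute exists in print, `Mochizuki2024JoshiReport`). Locator «p. N l. a–b» = lines a–b of page file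
`pNNNN.txt` of the cell render `HOME/lit/renders/Joshi-arxiv-2401.13508/` (PDF page N). Everything is TYPED AS A CANDIDATE (D-0012):
typed ≠ proved ≠ endorsed; Joshi's assertions are `def … : Prop` with `@[claim "Joshi2024ATS3" "disputed"]`, never asserted; what
FOLLOWS from the typed signature is a proved `theorem`. §12 is Joshi's reading of the SETTLED geometric Szpiro inequality
([Amorós–Bogomolov–Katzarkov–Pantev 2000], [Zhang 2001]; cf. [Mochizuki 2016]) as an analogue («a formulation (and a proof) of
[IUTchIII, Cor. 3.12] in the context of the geometric Szpiro inequality», p. 146 l. 17–19); nothing here bears on abc or on Cor. 3.12.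

CARRIER (interim-carrier rule, plan/E/ASSIGNMENTS.md §0.3; merge-debt: J3:§12.3–§12.8 = T-35 `Joshi/GeometricCase1.lean`): §§12.9–12.18
use from §§12.3–12.8 only `Y∞ = S̃L₂(ℝ) → X∞ = SL₂(ℝ)` with the central `ϕ∞ = z²` generating the kernel ((12.3.1) p. 146 l. 30;
Def. 12.5.1/(12.5.2) p. 147 l. 24–34), `S̃L₂(ℚ)`, `S̃L₂(ℤ)` (p. 146 l. 33 – p. 147 l. 3), `ℓ ≥ 5`, `ℓ*` (p. 149 l. 32–34) and the predicate
«`(g̃_1,…,g̃_{ℓ*})` provides `E_τ`» (Def. 12.8.3 p. 150 l. 25–32) — the fields of `HeightDatum` (abstract group `Y`; `Provides` abstract,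
to be replaced by a projection from T-35's typing; no decl of T-35 restated). The height `h` of §12.13 is defined in print by citation
([Zhang 2001, proof of Thm. 3.3]) and is likewise a field.

LOCATED, not adjudicated: (L1) §12.9 indexes the fibre of `S̃L₂(ℚ)^{ℓ*} → SL₂(ℚ)^{ℓ*}` (a `⟨ϕ∞⟩^{ℓ*}`-torsor, `LogThetaLattice.exists_zpow_frob`)
by one `m ∈ ℤ`; (L2) §12.16 announces a definition of the SET `Θ_classical(D) ⊃ Θ_classical` but Def. 12.16.1 defines only the NUMBER
`|Θ_classical(D)|` — the set is the abstract field `DomainLocus.carrier`; (L3) Thm. 12.18.1's printed binder «any choice of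
`(g̃_1,…,g̃_{ℓ*}) ∈ Θ_classical(D)`» does not occur in its conclusion (idle: `thm12181AsPrinted_iff`, companion file), while the proof uses that the
LIFT FAMILY `(γ̃_s^{(j)})` lies in `Θ_classical(D)` (`Thm12181Reading`, OUR READING) — the geometric analogue of the cell's residual
`Summit.ABC.IUTFork.Cor312Vol.PilotKummerIndRelated` («the q-pilot datum is one of the possible images of the Θ-pilot»). DERIVED in the
kernel: Lemma 12.16.2 and Thm. 12.18.1 from (12.14.1) + that membership (+ `S ≠ ∅`; `∏_{s∈S}` in the non-commutative `Y∞` read along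
a fixed enumeration of `S`); membership is NECESSARY for the first inequality (companion `Joshi/GeometricCase2Proofs.lean`). Sizes are in
`EReal` as in `Joshi/ThetaValuesLocus.lean` (junk values documented at `DomainLocus.size`). Remarks 12.9.1, 12.10.1, 12.14.2, 12.16.3,
12.18.2 are comparative prose, quoted at the decls they annotate. NOT here: §§12.1–12.8 (T-35), §12.19, a model of `S̃L₂(ℝ)` (Mathlib
has no universal cover of `SL₂(ℝ)`), the surjectivity `SL₂(ℤ) → SL₂(ℤ/ℓ)` behind «arbitrary lift», any test vs S (R14: object files
import no `Cor312*`; Thm. 12.18.1 is flagged to E-cx as the X-04 analogue), any judgement. [claim: Joshi2024ATS3, status: disputed]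
-/

noncomputable section

open scoped MatrixGroups

namespace Summit.ABC.IUTFork.Joshi.ATS3.GeoLocus

/-! ## 0. The signature §§12.9–12.18 read from §§12.3–12.8 and §12.13 (interim carrier; merge-debt T-35) -/

/-- **SIGNATURE `HeightDatum`** over an abstract group `Y` playing `Y∞ = S̃L₂(ℝ)` (Def. 12.5.1, p. 147 l. 24–26): `ℓ* ≥ 2` with
`ℓ = 2ℓ* + 1 ≥ 5` prime (p. 149 l. 32–34); the covering projection `Y∞ → X∞ = SL₂(ℝ)` (surjective) whose kernel is generated by
the central element `ϕ∞ = z²` ((12.3.1) p. 146 l. 28–32: «`1 → ⟨z²⟩ → S̃L₂(ℝ) → SL₂(ℝ) → 1` where `z` … generates the center»;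
(12.5.2) p. 147 l. 27–29); the stabilized logarithmic height `h : S̃L₂(ℝ) → ℝ` of §12.13 (p. 154 l. 1–10, = Zhang's `ℓ`); and the
abstract predicate `Provides g τ` = «`(g̃_1,…,g̃_{ℓ*})` provides `E_τ`» (§12.11 p. 153 l. 14–18; Def. 12.8.3 p. 150 l. 25–32,
typed by T-35 — merge-debt). HYPOTHESIS structure: nothing asserted, never instantiated here. [claim: Joshi2024ATS3, status: disputed] -/
structure HeightDatum (Y : Type) [Group Y] where
  /-- `ℓ* = (ℓ − 1)/2` (p. 149 l. 33) -/
  lstar : ℕ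
  /-- `ℓ ≥ 5`, i.e. `ℓ* ≥ 2` (p. 149 l. 32) -/
  two_le_lstar : 2 ≤ lstar
  /-- `ℓ = 2ℓ* + 1` is prime (p. 149 l. 32) -/
  ell_prime : (2 * lstar + 1).Prime
  /-- the covering map `Y∞ = S̃L₂(ℝ) → X∞ = SL₂(ℝ)` ((12.3.1); Def. 12.5.1) -/
  proj : Y →* SL(2, ℝ)
  /-- it is onto ((12.3.1) is exact on the right) -/
  proj_surjective : Function.Surjective proj
  /-- the global Frobenius morphism `ϕ∞ = z² ∈ S̃L₂(ℝ)` ((12.5.2) p. 147 l. 27) -/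
  frob : Y
  /-- `ϕ∞` is central (`z` generates the center, p. 146 l. 31) -/
  frob_comm : ∀ g : Y, g * frob = frob * g
  /-- `ker(Y∞ → X∞) = ⟨ϕ∞⟩` ((12.3.1); «`Y∞/ϕ∞^ℤ ≃ X∞`», p. 147 l. 29–34) -/
  ker_proj : proj.ker = Subgroup.zpowers frob
  /-- the stabilized logarithmic height `h : S̃L₂(ℝ) → ℝ` (§12.13 p. 154 l. 1–10; [Zhang 2001, proof of Thm. 3.3]) -/
  h : Y → ℝ
  /-- «`(g̃_1,…,g̃_{ℓ*})` provides `E_τ`» (§12.11 p. 153 l. 17; Def. 12.8.3) — abstract; T-35's Θgau-link predicate -/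
  Provides : (Fin lstar → Y) → UpperHalfPlane → Prop

namespace HeightDatum

variable {Y : Type} [Group Y] (G : HeightDatum Y)

/-- The prime `ℓ = 2ℓ* + 1` (p. 149 l. 32–33). [claim: Joshi2024ATS3, status: disputed] -/
def ell : ℕ := 2 * G.lstar + 1

/-- `0 < ℓ*` (from `ℓ ≥ 5`). [folklore] -/
theorem lstar_pos : 0 < G.lstar := lt_of_lt_of_le (by norm_num) G.two_le_lstar

/-- `S̃L₂(ℚ) ⊂ S̃L₂(ℝ)` = the inverse image of `SL₂(ℚ) ⊂ SL₂(ℝ)` (p. 147 l. 2–3). [claim: Joshi2024ATS3, status: disputed] -/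
def ratl : Subgroup Y :=
  (MonoidHom.range (Matrix.SpecialLinearGroup.map (Rat.castHom ℝ) : SL(2, ℚ) →* SL(2, ℝ))).comap G.proj

/-- `S̃L₂(ℤ) ⊂ S̃L₂(ℝ)` = the inverse image of `SL₂(ℤ) ⊂ SL₂(ℝ)` (p. 146 l. 33 – p. 147 l. 1; Rmk. 12.3.2: ≃ the braid group
on three letters — not used). [claim: Joshi2024ATS3, status: disputed] -/
def intl : Subgroup Y :=
  (MonoidHom.range (Matrix.SpecialLinearGroup.map (Int.castRingHom ℝ) : SL(2, ℤ) →* SL(2, ℝ))).comap G.proj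

/-- Two elements of `Y∞` over the same point of `X∞` differ by a power of `ϕ∞` (the content of (12.3.1) used in §12.9 and
Rmk. 12.6.2: «a chain of log-links is the fiber over `Y∞ → X∞`»). [folklore] -/
theorem exists_zpow_frob_of_proj_eq {g g' : Y} (hgg' : G.proj g = G.proj g') : ∃ k : ℤ, g' = g * G.frob ^ k := by
  have hk : g⁻¹ * g' ∈ G.proj.ker := by
    rw [MonoidHom.mem_ker, map_mul, map_inv, hgg', inv_mul_cancel]
  rw [G.ker_proj, Subgroup.mem_zpowers_iff] at hk
  obtain ⟨k, hk⟩ := hk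
  exact ⟨k, by rw [hk, mul_inv_cancel_left]⟩

/-! ## 1. §12.9 The log-Θ-lattice (p. 151 l. 34 – p. 152 l. 28) -/

/-- **§12.9 (p. 151 l. 38 – p. 152 l. 2)**: «Choose an enumerating function to enumerate … `SL₂(ℚ)^{ℓ*} = {θ_n : n ∈ ℤ}`. Then one
may enumerate … `S̃L₂(ℚ)^{ℓ*} = {θ_{n,m} : (n,m) ∈ ℤ × ℤ}`, with the canonical surjection `S̃L₂(ℚ)^{ℓ*} → SL₂(ℚ)^{ℓ*}` being
given by `θ_{n,m} ↦ θ_n`» — the CHOSEN enumerations as data; «the fiber over `θ_n` consists of log-links … the horizontal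
direction being … Θgau-links … [IUTchIII] calls this the log-Θ-lattice» (p. 152 l. 11–14). Rmk. 12.9.1 (p. 152 l. 27–28):
«This should be compared with Mochizuki's discussion of the log-Θ-lattice in [IUTchIII, §I, p. 405] and its construction in
[IUTchIII, §1, p. 427]» (our side: `Summit.ABC.IUTFork.Thm311.LatticeSituation`, columns `col : ℤ → Column`). LOCATED (L1): the
fibre over `θ_n` is a `⟨ϕ∞⟩^{ℓ*}`-torsor (`exists_zpow_frob`), indexed in print by one `m ∈ ℤ`. [claim: Joshi2024ATS3, status: disputed] -/
structure LogThetaLattice where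
  /-- `n ↦ θ_n`, onto `SL₂(ℚ)^{ℓ*}` -/
  thetaBase : ℤ → (Fin G.lstar → SL(2, ℚ))
  /-- every tuple is some `θ_n` -/
  thetaBase_surjective : Function.Surjective thetaBase
  /-- `(n, m) ↦ θ_{n,m} ∈ S̃L₂(ℚ)^{ℓ*}` -/
  theta : ℤ × ℤ → (Fin G.lstar → Y)
  /-- entries lie in `S̃L₂(ℚ)` -/
  theta_mem : ∀ (nm : ℤ × ℤ) (j : Fin G.lstar), theta nm j ∈ G.ratl
  /-- every tuple of `S̃L₂(ℚ)^{ℓ*}` is some `θ_{n,m}` -/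
  theta_surjective : ∀ g : Fin G.lstar → Y, (∀ j, g j ∈ G.ratl) → ∃ nm : ℤ × ℤ, theta nm = g
  /-- `θ_{n,m} ↦ θ_n` is the canonical surjection (coordinatewise projection) -/
  proj_theta : ∀ (n m : ℤ) (j : Fin G.lstar),
    G.proj (theta (n, m) j) = Matrix.SpecialLinearGroup.map (Rat.castHom ℝ) (thetaBase n j)

/-- DERIVED (§12.9 «the fiber over `θ_n` consists of log-links», p. 152 l. 11–12; Def. 12.6.1 log-link = `g̃' = g̃·ϕ∞`): two
members `θ_{n,m}`, `θ_{n,m'}` of one fibre differ in each coordinate by an (integer) iterate of `ϕ∞`. [folklore] -/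
theorem LogThetaLattice.exists_zpow_frob (Λ : G.LogThetaLattice) (n m m' : ℤ) (j : Fin G.lstar) :
    ∃ k : ℤ, Λ.theta (n, m') j = Λ.theta (n, m) j * G.frob ^ k :=
  G.exists_zpow_frob_of_proj_eq (by rw [Λ.proj_theta, Λ.proj_theta])

end HeightDatum

/-! ## 2. §12.10 Hodge structures from the Schottky parametrization (p. 152 l. 29 – p. 153 l. 10) -/

/-- **§12.10 (p. 152 l. 30–36)**: the group `Ext¹_{ℤ-MHS}(ℤ(0), ℤ(1))` of extensions of mixed Hodge structures with its
identification `≃ ℂ*` «given via [Deligne, 1997]», under which `H_Schottky(E_τ) = q_τ = e^{2π√−1 τ}`. SIGNATURE over an abstract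
carrier `Ext1` (Mathlib has no mixed Hodge structures); the identification is the field. Rmk. 12.10.1 (p. 152 l. 44 – p. 153
l. 3): «the Schottky parametrization … asserts that `E_τ` is ordinary at an archimedean prime … `H¹(E_τ, ℤ)` is pure of weight
one. Tate's parameterization … is the p-adic version» (prose). [claim: Joshi2024ATS3, status: disputed] -/
structure SchottkyHodgeDatum (Ext1 : Type) where
  /-- `Ext¹_{ℤ-MHS}(ℤ(0), ℤ(1)) ≃ ℂ*` [Deligne 1997, as cited p. 152 l. 34–35] -/
  deligne : Ext1 ≃ ℂˣ

namespace SchottkyHodgeDatum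

variable {Ext1 : Type} (H : SchottkyHodgeDatum Ext1)

/-- `H_Schottky` of the curve with Schottky parameter `q ∈ ℂ*` (p. 152 l. 36: `H_Schottky(E_τ) = q_τ`). [claim: Joshi2024ATS3, status: disputed] -/
def hSchottky (q : ℂˣ) : Ext1 := H.deligne.symm q

/-- **Lemma 12.10.2 (p. 153 l. 5–10)**, as the construction it asserts: a tuple `(q_{τ,1},…,q_{τ,ℓ*}) ∈ (ℂ*)^{ℓ*}` «provides a
tuple of ℤ-mixed Hodge structures `(H_Schottky(E_{τ,1}),…,H_Schottky(E_{τ,ℓ*})) ∈ Ext¹_{ℤ-MHS}(ℤ(0),ℤ(1))^{ℓ*}`». [claim: Joshi2024ATS3, status: disputed] -/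
def schottkyTuple {ι : Type} (q : ι → ℂˣ) : ι → Ext1 := fun j => H.hSchottky (q j)

/-- DERIVED: Lemma 12.10.2's tuple recovers the Schottky parameters under [Deligne 1997]. [folklore] -/
theorem deligne_schottkyTuple {ι : Type} (q : ι → ℂˣ) (j : ι) : H.deligne (H.schottkyTuple q j) = q j :=
  H.deligne.apply_symm_apply (q j)

end SchottkyHodgeDatum

namespace HeightDatum

variable {Y : Type} [Group Y] (G : HeightDatum Y)

/-! ## 3. §12.11–§12.12 The loci `Θ_classical,τ`, `Θ_classical`, `Θ^val_classical` (p. 153 l. 11–50) -/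

/-- **§12.11 (p. 153 l. 12–19)**: `Θ_classical,τ = {(g̃_1,…,g̃_{ℓ*}) ∈ S̃L₂(ℚ)^{ℓ*} ⊂ Y∞^{ℓ*} : (g̃_1,…,g̃_{ℓ*}) provides E_τ}`.
[claim: Joshi2024ATS3, status: disputed] -/
def thetaClassicalTau (τ : UpperHalfPlane) : Set (Fin G.lstar → Y) :=
  {g | (∀ j, g j ∈ G.ratl) ∧ G.Provides g τ}

/-- **(12.12.1) (p. 153 l. 28–39)**, for the periods `τ_s ∈ ℍ` near the singular points `s ∈ S` (§12.11 p. 153 l. 20–26; `S`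
enumerated as `Fin n`): `Θ_classical = {(g̃_{s,1},…,g̃_{s,ℓ*})_{s∈S} ∈ ∏_{s∈S} Y^{ℓ*}_{∞,s} : (g̃_{s,1},…,g̃_{s,ℓ*}) ∈ Θ_classical,τ_s
for all s ∈ S}`; «each [element] is the analog of the Θ-pilot object, in the sense of [IUTchIII]» (p. 153 l. 40–42; our side:
`Summit.ABC.IUTFork.Cor312.Setting.thetaPilot`). [claim: Joshi2024ATS3, status: disputed] -/
def thetaClassical {n : ℕ} (τs : Fin n → UpperHalfPlane) : Set (Fin n → Fin G.lstar → Y) :=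
  {g | ∀ s, g s ∈ G.thetaClassicalTau (τs s)}

/-- The Schottky parameter `q_{τ,j} = e^{2π√−1·j²·τ/2ℓ}` of `E_{τ,j} = E_{τ/2ℓ, j²}` (`j = 1,…,ℓ*`; convention p. 149 l. 34–37,
Def. 12.7.2 p. 149 l. 19–22, Thm. 12.8.5 (3) p. 151 l. 1–3) — restated minimally for `Θ^val` (merge-debt: T-35 `GeometricCase1`).
Index `j : Fin ℓ*` stands for `j + 1`. [claim: Joshi2024ATS3, status: disputed] -/
def schottkyParam (τ : UpperHalfPlane) (j : Fin G.lstar) : ℂˣ :=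
  Units.mk0 (Complex.exp (2 * Real.pi * Complex.I * (((j : ℕ) + 1 : ℂ) ^ 2) * (τ : ℂ) / (2 * (G.ell : ℂ))))
    (Complex.exp_ne_zero _)

/-- **§12.12 (p. 153 l. 43–50)**: the theta-values set `Θ^val_classical ⊂ Ext¹_{ℤ-MHS}(ℤ(0),ℤ(1))^{ℓ*}` «by taking the tuples of
Schottky parameters provided by each tuple `(g̃_{s,1},…,g̃_{s,ℓ*})_{s∈S} ∈ Θ_classical`» (via Thm. 12.8.5 (3) and Lemma 12.10.2).
[claim: Joshi2024ATS3, status: disputed] -/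
def thetaValClassical {Ext1 : Type} (H : SchottkyHodgeDatum Ext1) {n : ℕ} (τs : Fin n → UpperHalfPlane) :
    Set (Fin G.lstar → Ext1) :=
  {x | (G.thetaClassical τs).Nonempty ∧ ∃ s : Fin n, x = H.schottkyTuple (G.schottkyParam (τs s))}

/-! ## 4. §12.13–§12.15 The stabilized heights `h`, `H` and their two printed properties (p. 154 l. 1 – p. 155 l. 25) -/

/-- **§12.13 (p. 154 l. 6–10)**: `H = e^h : S̃L₂(ℝ) → ℝ`, the (Frobenius-)stabilized height. [claim: Joshi2024ATS3, status: disputed] -/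
def H (g : Y) : ℝ := Real.exp (G.h g)

/-- **(12.14.1) (p. 154 l. 11–14)**: «By [Zhang, 2001] one has for any `g̃₁, g̃₂ ∈ S̃L₂(ℝ)`: `h(g̃₁·g̃₂) ≤ h(g̃₁) + h(g̃₂)`» —
«the central point in the proofs of [ABKP 2000, Zhang 2001]». Asserted by citation; typed as a CLAIM-Prop (hypothesis), never
asserted here. [claim: Joshi2024ATS3, status: disputed] -/
@[claim "Joshi2024ATS3" "disputed"]
def HeightSubadditive : Prop := ∀ g₁ g₂ : Y, G.h (g₁ * g₂) ≤ G.h g₁ + G.h g₂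

/-- **(12.15.1) (p. 155 l. 2–21)**: if `g̃' = g̃·ϕ∞^m` («differ by the m-th iterate of the global Frobenius», Def. 12.6.1) then
«`h(g̃') = h(g̃·ϕ∞^m) ≤ h(g̃) + π·m ∈ ℝ` (where `π ∈ ℝ` is the familiar real number)», «established in [Zhang, 2001, Proof of
the Geometric Szpiro Inequality]»; `m ∈ ℤ` as printed. CLAIM-Prop. [claim: Joshi2024ATS3, status: disputed] -/
@[claim "Joshi2024ATS3" "disputed"]
def HeightLogLinkBound : Prop := ∀ (g : Y) (m : ℤ), G.h (g * G.frob ^ m) ≤ G.h g + Real.pi * m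

/-- `∑_{s∈S} ∑_{j=1}^{ℓ*} h(g̃_{s,j})` — the sums of Def. 12.16.1 / Thm. 12.18.1 (p. 155 l. 31–38). [claim: Joshi2024ATS3, status: disputed] -/
def hSum {n : ℕ} (g : Fin n → Fin G.lstar → Y) : ℝ := ∑ s, ∑ j, G.h (g s j)

/-- `g̃_{s,1}·g̃_{s,2}⋯g̃_{s,ℓ*} ∈ Y∞` (p. 154 l. 15–18), the ordered product over `j = 1,…,ℓ*`. [claim: Joshi2024ATS3, status: disputed] -/
def rowProd {n : ℕ} (g : Fin n → Fin G.lstar → Y) (s : Fin n) : Y := (List.ofFn (g s)).prod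

/-- `∏_{s∈S} (g̃_{s,1}⋯g̃_{s,ℓ*})` (Thm. 12.18.1, p. 156 l. 39–45) — in the non-commutative `Y∞` this presupposes an ORDER on
`S`; read for the fixed enumeration `S = {s_0,…,s_{n−1}}` (OUR READING; print writes `∏_{s∈S}`). [claim: Joshi2024ATS3, status: disputed] -/
def totalProd {n : ℕ} (g : Fin n → Fin G.lstar → Y) : Y := (List.ofFn fun s => G.rowProd g s).prod

/-- `∑_{s∈S} h(g̃_{s,1}·g̃_{s,2}⋯g̃_{s,ℓ*})` — «the quantity of interest to us» (p. 154 l. 15–18). [claim: Joshi2024ATS3, status: disputed] -/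
def prodSum {n : ℕ} (g : Fin n → Fin G.lstar → Y) : ℝ := ∑ s, G.h (G.rowProd g s)

/-- DERIVED from (12.14.1): `h` of a non-empty ordered product is at most the sum of the `h`'s. [folklore] -/
theorem h_prod_le_sum (hsub : G.HeightSubadditive) : ∀ l : List Y, l ≠ [] → G.h l.prod ≤ (l.map G.h).sum
  | [], hl => (hl rfl).elim
  | [x], _ => by simp
  | x :: y :: t, _ => by
      have ih := h_prod_le_sum hsub (y :: t) (List.cons_ne_nil y t)
      rw [List.prod_cons, List.map_cons, List.sum_cons]
      exact (hsub x _).trans (add_le_add le_rfl ih)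

/-- DERIVED: `h(g̃_{s,1}⋯g̃_{s,ℓ*}) ≤ ∑_j h(g̃_{s,j})` (uses `ℓ* ≥ 1`). [folklore] -/
theorem h_rowProd_le (hsub : G.HeightSubadditive) {n : ℕ} (g : Fin n → Fin G.lstar → Y) (s : Fin n) :
    G.h (G.rowProd g s) ≤ ∑ j, G.h (g s j) := by
  have hne : List.ofFn (g s) ≠ [] := by rw [Ne, List.ofFn_eq_nil_iff]; exact (G.lstar_pos).ne'
  have := G.h_prod_le_sum hsub _ hne
  rwa [List.map_ofFn, List.sum_ofFn] at this

/-- DERIVED — the displayed inequality p. 154 l. 19–28: `∑_s h(g̃_{s,1}⋯g̃_{s,ℓ*}) ≤ ∑_s ∑_j h(g̃_{s,j})`. [folklore] -/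
theorem prodSum_le_hSum (hsub : G.HeightSubadditive) {n : ℕ} (g : Fin n → Fin G.lstar → Y) : G.prodSum g ≤ G.hSum g :=
  Finset.sum_le_sum fun s _ => G.h_rowProd_le hsub g s

/-- DERIVED: `h(∏_s (g̃_{s,1}⋯g̃_{s,ℓ*})) ≤ ∑_s h(g̃_{s,1}⋯g̃_{s,ℓ*})` for `S ≠ ∅`. [folklore] -/
theorem h_totalProd_le (hsub : G.HeightSubadditive) {n : ℕ} (hn : 0 < n) (g : Fin n → Fin G.lstar → Y) :
    G.h (G.totalProd g) ≤ G.prodSum g := by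
  have hne : (List.ofFn fun s => G.rowProd g s) ≠ [] := by rw [Ne, List.ofFn_eq_nil_iff]; exact hn.ne'
  have := G.h_prod_le_sum hsub _ hne
  rwa [List.map_ofFn, List.sum_ofFn] at this

/-! ## 5. §12.16 `Θ_classical(D)` and `|Θ_classical(D)|` (p. 155 l. 26–51) -/

/-- **§12.16 (p. 155 l. 26–30)**: «let `S ⊂ D ⊂ C(ℂ)` be a subset containing `S` such that the local theory of [Zhang, 2001] can be
applied (for example … the disjoint union of small disks `D_s` around each `s ∈ S`). Then it is possible to define
`Θ_classical(D) ⊃ Θ_classical` as follows» — LOCATED (L2): print then defines only `|Θ_classical(D)|` (Def. 12.16.1); the SET is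
typed as the abstract field `carrier` over the `n = |S|` singular points and their periods `τ_s` (§12.11), with the printed
inclusion as a field. «Working with a compact domain `D` is analogous to working with compactly bounded domains (in the sense of
[GenEll]) in the proof of the main theorem of [IUTchIV]» (Rmk. 12.16.3, p. 155 l. 49–51). [claim: Joshi2024ATS3, status: disputed] -/
structure DomainLocus (n : ℕ) where
  /-- the periods `τ_s ∈ ℍ` near the singular points `s ∈ S` (§12.11 p. 153 l. 20–26) -/
  centre : Fin n → UpperHalfPlane
  /-- `Θ_classical(D) ⊂ ∏_{s∈S} Y∞^{ℓ*}` — NOT DEFINED IN PRINT (p. 155 l. 26–29); abstract -/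
  carrier : Set (Fin n → Fin G.lstar → Y)
  /-- the printed inclusion `Θ_classical(D) ⊃ Θ_classical` (p. 155 l. 29) -/
  thetaClassical_subset : G.thetaClassical centre ⊆ carrier

namespace DomainLocus

variable {G} {n : ℕ} (L : G.DomainLocus n)

/-- **Definition 12.16.1 (p. 155 l. 30–39)**: `|Θ_classical(D)| = sup{∑_{s∈S} ∑_{j=1}^{ℓ*} h(g̃_{s,j}) : (g̃_{s,1},…,g̃_{s,ℓ*})_{s∈S} ∈
Θ_classical(D)}`, typed in `EReal` (junk values, documented: `⊥` iff `Θ_classical(D) = ∅`, `⊤` if the sums are unbounded; print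
is silent on finiteness). Our side's analogue: `Summit.ABC.IUTFork.Cor312.Setting.negLogTheta : WithTop ℝ`. [claim: Joshi2024ATS3, status: disputed] -/
def size : EReal := ⨆ g ∈ L.carrier, ((G.hSum g : ℝ) : EReal)

/-- **Lemma 12.16.2 (p. 155 l. 41–46)**: `|Θ_classical(D)| ≥ sup{∑_{s∈S} h(g̃_{s,1}·g̃_2⋯g̃_{s,ℓ*}) : (g̃_{s,j})_{s∈S} ∈ Θ_classical(D)}`
(«immediate from … (12.14.1) … and the definition», p. 155 l. 47–48). CLAIM-Prop; DERIVED below. [claim: Joshi2024ATS3, status: disputed] -/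
@[claim "Joshi2024ATS3" "disputed"]
def Lem12162 : Prop := (⨆ g ∈ L.carrier, ((G.prodSum g : ℝ) : EReal)) ≤ L.size

/-- DERIVED: Lemma 12.16.2 follows from (12.14.1) alone (no finiteness of the supremum needed in `EReal`). [folklore] -/
theorem lem12162_of_subadditive (hsub : G.HeightSubadditive) : L.Lem12162 :=
  iSup₂_mono fun g _ => EReal.coe_le_coe_iff.2 (G.prodSum_le_hSum hsub g)

/-- DERIVED: any member's sum is dominated by `|Θ_classical(D)|` («the supremum of all such sums», p. 156 l. 48–49). [folklore] -/
theorem hSum_le_size {g : Fin n → Fin G.lstar → Y} (hg : g ∈ L.carrier) : ((G.hSum g : ℝ) : EReal) ≤ L.size :=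
  le_iSup₂ (f := fun g' (_ : g' ∈ L.carrier) => ((G.hSum g' : ℝ) : EReal)) g hg

end DomainLocus

/-- `g̃ ∈ S̃L₂(ℤ)` is a LIFT of `A ∈ SL₂(ℤ/ℓ)`: `g̃` lies over some `B ∈ SL₂(ℤ) ⊂ SL₂(ℝ)` reducing to `A` (p. 156 l. 23–25: «let
`γ̃_s^{(j)} ∈ S̃L₂(ℤ)` be an arbitrary lift of `ρ_ℓ(γ_s^{j²})`»; lifts exist since `SL₂(ℤ) → SL₂(ℤ/ℓ)` and `Y∞ → X∞` are onto — not
re-proved here). [claim: Joshi2024ATS3, status: disputed] -/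
def IsLiftOf (g : Y) (A : SL(2, ZMod G.ell)) : Prop :=
  ∃ B : SL(2, ℤ), G.proj g = Matrix.SpecialLinearGroup.map (Int.castRingHom ℝ) B ∧
    Matrix.SpecialLinearGroup.map (Int.castRingHom (ZMod G.ell)) B = A

end HeightDatum

/-! ## 6. §12.17 The monodromy representation and its reduction modulo `ℓ` (p. 156 l. 1–25) -/

/-- **§12.17 (p. 156 l. 1–21)** over an abstract group `Π` playing `π₁^top(C(ℂ) − S, *)`: «a group with `2g + |S|` generators
`a_1, b_1, …, a_g, b_g, {γ_s}_{s∈S}` and one relation `∏_{j=1}^g [a_j, b_j] ∏_{s∈S} γ_s = 1`»; the monodromy representation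
`ρ : π₁^top(C(ℂ) − S, *) → Aut(H₁(X_t, ℤ))` on the homology of a general fibre `X_t` — typed into `SL₂(ℤ)` (`H₁(X_t, ℤ) ≅ ℤ²`
with its intersection form, which monodromy preserves; OUR typing choice) — and «its "reduction modulo ℓ"
`ρ_ℓ : π₁ → Aut(H₁(X_t, ℤ/ℓ))`» (`rhoL`). SIGNATURE; nothing asserted. [claim: Joshi2024ATS3, status: disputed] -/
structure MonodromyDatum (Pi : Type) [Group Pi] (genus n : ℕ) where
  /-- the generators `a_1,…,a_g` -/
  a : Fin genus → Pi
  /-- the generators `b_1,…,b_g` -/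
  b : Fin genus → Pi
  /-- the loops `γ_s` around the singular points `s ∈ S` -/
  loop : Fin n → Pi
  /-- they generate (p. 156 l. 4–5) -/
  closure_eq_top : Subgroup.closure (Set.range a ∪ Set.range b ∪ Set.range loop) = ⊤
  /-- the one relation `∏_j [a_j, b_j] · ∏_s γ_s = 1` (p. 156 l. 6–12) -/
  relation : (List.ofFn fun i => a i * b i * (a i)⁻¹ * (b i)⁻¹).prod * (List.ofFn loop).prod = 1
  /-- the monodromy representation `ρ` on `H₁(X_t, ℤ) ≅ ℤ²` (p. 156 l. 13–16) -/
  rho : Pi →* SL(2, ℤ)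

namespace MonodromyDatum

variable {Y : Type} [Group Y] (G : HeightDatum Y) {Pi : Type} [Group Pi] {genus n : ℕ} (M : MonodromyDatum Pi genus n)

/-- `ρ_ℓ`, the reduction of `ρ` modulo `ℓ = G.ell` (p. 156 l. 17–19); used as `M.rhoL G`. [claim: Joshi2024ATS3, status: disputed] -/
def rhoL : Pi →* SL(2, ZMod G.ell) := (Matrix.SpecialLinearGroup.map (Int.castRingHom (ZMod G.ell))).comp M.rho

/-- «One can assume without any loss of generality that `ρ_ℓ` is irreducible otherwise by a classical argument due to Faltings,
Szpiro's inequality is trivial» (p. 156 l. 20–21): no `ρ_ℓ(π₁)`-stable subspace of `(ℤ/ℓ)²` other than `0` and the whole space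
(cf. Rmk. 12.18.2: «there does not exist any natural one dimensional subspace (globally) in `ρ_ℓ`»). CLAIM-Prop / standing
assumption, never asserted. [claim: Joshi2024ATS3, status: disputed] -/
@[claim "Joshi2024ATS3" "disputed"]
def RhoLIrreducible : Prop :=
  ∀ W : Submodule (ZMod G.ell) (Fin 2 → ZMod G.ell),
    (∀ (x : Pi), ∀ v ∈ W, (M.rhoL G x).1.mulVec v ∈ W) → W = ⊥ ∨ W = ⊤

/-- A family `(γ̃_s^{(j)})_{s∈S, j=1..ℓ*}` of lifts: `γ̃_s^{(j)}` lifts `ρ_ℓ(γ_s^{j²}) = ρ_ℓ(γ_s)^{j²}` (p. 156 l. 23–25; index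
`j : Fin ℓ*` stands for `j + 1`). [claim: Joshi2024ATS3, status: disputed] -/
def IsLiftFamily (γt : Fin n → Fin G.lstar → Y) : Prop :=
  ∀ (s : Fin n) (j : Fin G.lstar), G.IsLiftOf (γt s j) (M.rhoL G (M.loop s) ^ (((j : ℕ) + 1) ^ 2))

end MonodromyDatum

/-! ## 7. §12.18 «Mochizuki's Corollary 3.12 in the geometric case» (p. 156 l. 26–69) -/

namespace HeightDatum

variable {Y : Type} [Group Y] (G : HeightDatum Y)

/-- **Theorem 12.18.1 (p. 156 l. 29–46)**, its two inequalities for a given family `γ̃ = (γ̃_s^{(j)})`: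
`|Θ_classical(D)| ≥ ∑_{s∈S} ∑_{j=1}^{ℓ*} h(γ̃_s^{(j)}) ≥ h(∏_{s∈S} γ̃_s^{(1)}·γ̃_s^{(2)}⋯γ̃_s^{(ℓ*)})` («[IUTchIII, Cor. 3.12] now has a
simple formulation with a tautological proof», p. 156 l. 26–28; our side's shape: `Summit.ABC.IUTFork.Cor312.Setting.Statement`,
`−|log(q)| ≤ −|log(Θ)|`). Rmk. 12.18.2 (p. 156 l. 50–69): the product is «a "simulation" of a "multiplicative" one dimensional
subspace of `ρ_ℓ`», which has none globally as `ρ_ℓ` is irreducible. [claim: Joshi2024ATS3, status: disputed] -/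
@[claim "Joshi2024ATS3" "disputed"]
def Thm12181 {n : ℕ} (L : G.DomainLocus n) (γt : Fin n → Fin G.lstar → Y) : Prop :=
  ((G.hSum γt : ℝ) : EReal) ≤ L.size ∧ G.h (G.totalProd γt) ≤ G.hSum γt

/-- **Theorem 12.18.1 with its binders VERBATIM**: «For a compact domain `D` as above, and any choice of `(g̃_1,…,g̃_{ℓ*}) ∈
Θ_classical(D)`, one has [the two inequalities]» for the lifts `γ̃_s^{(j)}` of §12.17 — the bound tuple `g̃` does not occur in
the conclusion (idle once `Θ_classical(D) ≠ ∅`: companion file `GeometricCase2Proofs`). [claim: Joshi2024ATS3, status: disputed] -/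
@[claim "Joshi2024ATS3" "disputed"]
def Thm12181AsPrinted {Pi : Type} [Group Pi] {genus n : ℕ} (L : G.DomainLocus n) (M : MonodromyDatum Pi genus n) : Prop :=
  ∀ g ∈ L.carrier, ∀ γt : Fin n → Fin G.lstar → Y, M.IsLiftFamily G γt → G.Thm12181 L γt

/-- **OUR READING of Theorem 12.18.1** = the statement its printed PROOF establishes (not the displayed sentence): the
hypothesis is that the lift family `(γ̃_s^{(j)})_{s,j}` ITSELF lies in `Θ_classical(D)` — what «by Definition 12.16.1,
`|Θ_classical(D)|` is the supremum of all such sums» (p. 156 l. 47–49) uses, and where the choice of `D` («such that the local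
theory of [Zhang, 2001] can be applied», p. 155 l. 27–28) enters. LOCATED (L3): this membership is the geometric analogue of the
cell's residual `Summit.ABC.IUTFork.Cor312Vol.PilotKummerIndRelated` (the q-pilot datum is one of the possible images of the
Θ-pilot); it is not among the displayed hypotheses. [claim: Joshi2024ATS3, status: disputed] -/
@[claim "Joshi2024ATS3" "disputed"]
def Thm12181Reading {Pi : Type} [Group Pi] {genus n : ℕ} (L : G.DomainLocus n) (M : MonodromyDatum Pi genus n) : Prop :=
  ∀ γt : Fin n → Fin G.lstar → Y, M.IsLiftFamily G γt → γt ∈ L.carrier → G.Thm12181 L γt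

/-- DERIVED — the «tautological proof» in the kernel: (12.14.1) + MEMBERSHIP `γ̃ ∈ Θ_classical(D)` + `S ≠ ∅` give both
inequalities of Theorem 12.18.1 (first: `hSum_le_size`; second: subadditivity along the fixed enumeration of `S × {1..ℓ*}`).
[folklore] -/
theorem thm12181_of_mem (hsub : G.HeightSubadditive) {n : ℕ} (hn : 0 < n) (L : G.DomainLocus n)
    {γt : Fin n → Fin G.lstar → Y} (hmem : γt ∈ L.carrier) : G.Thm12181 L γt :=
  ⟨L.hSum_le_size hmem, (G.h_totalProd_le hsub hn γt).trans (G.prodSum_le_hSum hsub γt)⟩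

/-- DERIVED: under (12.14.1) and `S ≠ ∅`, OUR READING of Theorem 12.18.1 holds for every domain locus and every monodromy datum
(the lift condition is not used). [folklore] -/
theorem thm12181Reading_of_subadditive (hsub : G.HeightSubadditive) {Pi : Type} [Group Pi] {genus n : ℕ} (hn : 0 < n)
    (L : G.DomainLocus n) (M : MonodromyDatum Pi genus n) : G.Thm12181Reading L M :=
  fun _ _ hmem => G.thm12181_of_mem hsub hn L hmem

end HeightDatum

end Summit.ABC.IUTFork.Joshi.ATS3.GeoLocus
-- enqueue re-land 2026-08-26T08:01Z (stranded accept p430006 07:00:09Z, no olean; decls byte-identical, no content change)
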